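import Mathlib
import Summits.AtomisticToContinuum.Crystallization.Theorems.GappedShellCensusCleanLimitsHaveWindowsDefs

/-!
# Laminar vocabulary for the crux `GappedShellCensus.CleanLimitsHaveWindows` (stmt-AtomisticToContinuum-15932), line `Sketch`

Objects posited by the laminar reshape of the exactification step (lead prover-line-stmt-AtomisticToContinuum-15932-c3-0, after the
crux strategist's typed kernel `Cruxes/CleanLimitsHaveWindows/LaminarKernelSketch.lean`), used in the registered stubs
`stub_laminarIroning`, `stub_laminarClosingOfCoercivity`, `stub_laminarRigidity` of the skeleton `Lines/Sketch.lean`: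

* `laminarSlotC u v w₁ w₂`, `laminarSlotH u v w₁ w₂` — the twelve neighbour offsets of a site of a LAMINAR set (every layer an exact
  translate of one planar lattice; metric, registry slips, heights and orientation free): the lattice hexagon `±u, ±v, ±(u − v)` and two
  exact lattice triangles above and below, of cubic type (staggered lower triangle) or hexagonal type (eclipsed lower triangle). For
  `u = t₁(a′)`, `v = t₂(a′)`, `w₁ = h⁺e₃ + w(a′)`, `w₂ = −h⁻e₃ ∓ w(a′)` these are `slotC a′ h⁺ h⁻` / `slotH a′ h⁺ h⁻` of `…Defs.lean`;
* `posMisfit p q slot` — the POSITION misfit `Σ_k ‖(q k − p) − slot k‖²` of a labelled 12-cluster about `p` against a slot model;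
* `laminarDefect a Z p` — the LAMINAR DEFECT of `Z` at `p`: the infimum over labellings of the bond shell by `Fin 12`, over the slot
  parameters `(u, v, w₁, w₂) ∈ (ℝ³)⁴` and over the two types, of the position misfit. It vanishes exactly when the bond shell of `p` is a
  laminar shell; it is dominated by the transversal defect's exact-layering requirement (an exactly layered shell is laminar), so the
  laminar kernel claims strictly less than `stub_trussCoercivity` did: no homogeneous (metric / slip / height) mode is charged.

No facts are asserted here beyond non-negativity.
-/

noncomputable section

namespace Summit.AtomisticToContinuum.Crystallization.Theorems.CleanHull

open Literature.MathematicalPhysics.StatisticalMechanics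

/-- Laminar slot model of CUBIC local type: in-plane lattice hexagon `±u, ±v, ±(u − v)`, upper triangle `w₁ − {0, u, v}`, lower
triangle `w₂ + {0, u, v}` (staggered with the upper one); `u, v, w₁, w₂` are arbitrary vectors. [folklore] -/
def laminarSlotC (u v w₁ w₂ : EuclideanSpace ℝ (Fin 3)) : Fin 12 → EuclideanSpace ℝ (Fin 3) :=
  ![u, -u, v, -v, u - v, v - u, w₁, w₁ - u, w₁ - v, w₂, w₂ + u, w₂ + v]

/-- Laminar slot model of HEXAGONAL local type: as `laminarSlotC` but with the lower triangle `w₂ − {0, u, v}` eclipsed with the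
upper one. [folklore] -/
def laminarSlotH (u v w₁ w₂ : EuclideanSpace ℝ (Fin 3)) : Fin 12 → EuclideanSpace ℝ (Fin 3) :=
  ![u, -u, v, -v, u - v, v - u, w₁, w₁ - u, w₁ - v, w₂, w₂ - u, w₂ - v]

/-- Position misfit of a labelled 12-cluster `q` about the centre `p` against a slot model: `Σ_k ‖(q k − p) − slot k‖²`; zero iff
`q k = p + slot k` for every label. [folklore] -/
def posMisfit (p : EuclideanSpace ℝ (Fin 3)) (q slot : Fin 12 → EuclideanSpace ℝ (Fin 3)) : ℝ :=
  ∑ k : Fin 12, ‖q k - p - slot k‖ ^ 2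

/-- **The laminar defect** of `Z` at `p` (scale `a`): the infimum over labellings `e` of the bond shell of `p` by `Fin 12`, over
the slot parameters `(u, v, w₁, w₂) ∈ (ℝ³)⁴` and over the two local types, of the position misfit against the laminar slot model.
(If the bond shell does not have exactly twelve points the labelling type is empty and the value is the junk `0`.) [folklore] -/
def laminarDefect (a : ℝ) (Z : Set (EuclideanSpace ℝ (Fin 3))) (p : EuclideanSpace ℝ (Fin 3)) : ℝ :=
  ⨅ e : ↥(bondShell a Z p) ≃ Fin 12,
    ⨅ θ : (EuclideanSpace ℝ (Fin 3)) × (EuclideanSpace ℝ (Fin 3)) × (EuclideanSpace ℝ (Fin 3)) × (EuclideanSpace ℝ (Fin 3)),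
      min (posMisfit p (fun k => (e.symm k : EuclideanSpace ℝ (Fin 3))) (laminarSlotC θ.1 θ.2.1 θ.2.2.1 θ.2.2.2))
        (posMisfit p (fun k => (e.symm k : EuclideanSpace ℝ (Fin 3))) (laminarSlotH θ.1 θ.2.1 θ.2.2.1 θ.2.2.2))

/-- The position misfit is non-negative. [folklore] -/
theorem posMisfit_nonneg (p : EuclideanSpace ℝ (Fin 3)) (q slot : Fin 12 → EuclideanSpace ℝ (Fin 3)) :
    0 ≤ posMisfit p q slot :=
  Finset.sum_nonneg fun _ _ => sq_nonneg _

/-- The laminar defect is non-negative. [folklore] -/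
theorem laminarDefect_nonneg (a : ℝ) (Z : Set (EuclideanSpace ℝ (Fin 3))) (p : EuclideanSpace ℝ (Fin 3)) :
    0 ≤ laminarDefect a Z p :=
  Real.iInf_nonneg fun _ => Real.iInf_nonneg fun _ => le_min (posMisfit_nonneg _ _ _) (posMisfit_nonneg _ _ _)

end Summit.AtomisticToContinuum.Crystallization.Theorems.CleanHull

end
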